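/-
Copyright (c) 2026. All rights reserved.
Released under Apache 2.0 license as described in the file LICENSE.
-/
import Literature.NumberTheory.GelbartRogawski1991.DoubledUnitaryGlobalSplittingData
import Literature.NumberTheory.Weil1964.AdelicDoublingDeltaOriginValue
import HarnessLib

/-!
# `(ω^𝔻(r_F^𝔻 δ) Φ)(0)` for the doubled unitary datum of [GelbartRogawski1991, §3.1]: Li's
# diagonal-kernel identity and the non-vanishing of the doubled vacuum value

Topic `NumberTheory/GelbartRogawski1991`; namespace
`Literature.NumberTheory.GelbartRogawski1991.GRConstruction`.  KERNEL MATHEMATICS ONLY (theorems over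
existing tree declarations; no `def … : Prop`, no `axiom`, no proof hole).

`DoubledUnitaryGlobalSplittingData` fixes, for the CM datum `(L, e, dV, dW)`, the doubled Gram matrix
`gramDA = T^𝔻 ⊗ 1 ∈ M_{n+n}(𝔸_{L⁺})`, the metaplectic group of record `MpD`, Weil's rational section
`rFD = r_F^𝔻`, the rational symplectic element `deltaD = δ` and `rDelta = r_F^𝔻(δ)`, and the Weil
operator `opD q Φ` as a function on `𝔸_{L⁺}^{n+n}`; the interface Prop `IsDoubledWeilRep χ sD` pins
`sD` on the Siegel parabolic `P_Δ` through the value-at-the-origin scalar of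
`r_F^𝔻(δ) · sD(p) · r_F^𝔻(δ)⁻¹`.  This file identifies that currency with the doubling files of
`Weil1964` (`AdelicDoublingDiagonalLift`, `AdelicDoublingDeltaOriginValue`) and reads off Li's identity
[Li1992, (13) pp. 181–182] for `rDelta` (`e₂ = finSumFinEquiv`, `R_{e₂} = piSBReindex L⁺ e₂`):

* §1 `gramDA_eq_doubledGramFin`: `T^𝔻 ⊗ 1 = doubledGramFin L⁺ (T ⊗ 1)`; `isUnit_gramR`: `T ∈ GL_n(L⁺)`;
  `deltaD_eq_doublingDeltaRat`: `δ = doublingDeltaRat L⁺` (definitional), hence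
  `rDelta_eq_rFD_doublingDeltaRat`;
* §2 **`ν(D^n) · (opD rDelta Φ)(0) = ∫_{𝔸_{L⁺}^n} Φ((u,u) ∘ e₂⁻¹) dν`** for every additive Haar measure
  `ν`, its forms on `R_{e₂} Ψ` and `R_{e₂}(φ₁ ⊠ φ̄₂)` (`= ∫ φ₁ φ̄₂ dν`), and the Tamagawa-normalised
  versions (`ν(D^n) = 1`, [HarrisKudlaSweet1996, (1.16) p. 952]);
* §3 **non-vanishing**: `(opD rDelta (R_{e₂}(φ ⊠ φ̄)))(0) ≠ 0` for every `φ ≠ 0` in `𝒮(𝔸_{L⁺}^n)`, no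
  measure in the statement (`Weil1964.omega_ratThetaLiftCont_doublingDeltaRat_boxConj_apply_zero_ne_zero`),
  and `opD_rDelta_apply_zero_ne_zero_of_diag_nonneg`: `(opD rDelta Φ)(0) ≠ 0` for ANY `Φ` whose
  diagonal restriction is a non-negative real function, not identically zero (e.g. a doubled vacuum,
  with no product decomposition of `Φ` needed).
-/

set_option autoImplicit false

noncomputable section

open scoped Classical
open scoped Matrix ComplexConjugate
open NumberField IsDedekindDomain _root_.MeasureTheory _root_.MeasureTheory.Measure
open Literature.RepresentationTheory.HeisenbergGroup
open Literature.NumberTheory.Automorphic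
open Literature.NumberTheory.Weil1964

namespace Literature.NumberTheory.GelbartRogawski1991.GRConstruction

open scoped ComplexOrder

open UnitaryDualPair

variable (L : Type) [Field L] [NumberField L] [IsCMField L]

variable {N M n : ℕ} (e : Fin N × Fin M ≃ Fin n)
  (dV : Fin N → L) (hdV : ∀ i, IsCMField.complexConj L (dV i) = dV i) (hdV0 : ∀ i, dV i ≠ 0)
  (dW : Fin M → L) (hdW : ∀ i, IsCMField.complexConj L (dW i) = dW i) (hdW0 : ∀ i, dW i ≠ 0)

/-! ## §1 The doubled currency of record is the doubling currency of `Weil1964` -/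

/-- **`T^𝔻 ⊗ 1 = doubledGramFin L⁺ (T ⊗ 1)`**: the doubled adelic Gram matrix of record is the `Weil1964`
doubling file's `doubledGramFin` of the adelic Gram matrix `T ⊗ 1` (`map` commutes with `reindex` and
`fromBlocks`). [cite: GelbartRogawski1991, §3.1 Prop. 3.1.1 p. 455 L1–2] -/
theorem gramDA_eq_doubledGramFin :
    gramDA L e dV hdV dW hdW = doubledGramFin (Fp L) ((gramR L e dV hdV dW hdW).map (algebraMap (Fp L)
      (AdeleRing (𝓞 (Fp L)) (Fp L)))) := by
  unfold gramDA gramD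
  simp only [Matrix.reindex_apply, ← Matrix.submatrix_map, Matrix.fromBlocks_map,
    Matrix.map_zero _ (map_zero (algebraMap (Fp L) (AdeleRing (𝓞 (Fp L)) (Fp L)))), Matrix.map_neg _
      (map_neg (algebraMap (Fp L) (AdeleRing (𝓞 (Fp L)) (Fp L))))]

include hdV0 hdW0 in
/-- `T ∈ GL_n(L⁺)` (`det T` is a unit: `isUnit_det_gram`, `isUnit_det_realDiagonal`).
[cite: GelbartRogawski1991, §3.1 Prop. 3.1.1 p. 455 L1–2] -/
theorem isUnit_gramR : IsUnit (gramR L e dV hdV dW hdW) :=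
  (Matrix.isUnit_iff_isUnit_det _).2
    (isUnit_det_gram (Fp L) e (isUnit_det_realDiagonal L dV hdV hdV0) (isUnit_det_realDiagonal L dW hdW hdW0))

omit [NumberField L] [IsCMField L] in
/-- **`δ = doublingDeltaRat L⁺`** (both are `deltaDiag` re-enumerated by `e₂ ⊕ e₂`; definitional).
[cite: GelbartRogawski1991, §3.1 Prop. 3.1.1 p. 455 L1–2] [cite: Li1992, p. 181] -/
theorem deltaD_eq_doublingDeltaRat : (deltaD L : Matrix.symplecticGroup (Fin (n + n)) (Fp L))
    = doublingDeltaRat (Fp L) :=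
  Subtype.ext rfl

/-- `r_F^𝔻(δ) = r_F(doublingDeltaRat L⁺)` in `Mp(𝕎^𝔻)ᶜᵒⁿᵗ`.
[cite: GelbartRogawski1991, §3.1 Prop. 3.1.1 p. 455 L1–2] -/
theorem rDelta_eq_rFD_doublingDeltaRat :
    rDelta L e dV hdV hdV0 dW hdW hdW0 = rFD L e dV hdV hdV0 dW hdW hdW0 (doublingDeltaRat (Fp L)) :=
  congrArg (rFD L e dV hdV hdV0 dW hdW hdW0) (deltaD_eq_doublingDeltaRat L)

/-! ## §2 Li's identity for `rDelta`: `ν(D^n) · (opD rDelta Φ)(0) = ∫ Φ(u^Δ) dν` -/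

section Measure

variable [MeasurableSpace (AdeleRing (𝓞 (Fp L)) (Fp L))] [BorelSpace (AdeleRing (𝓞 (Fp L)) (Fp L))]
  (ν : Measure (Fin n → AdeleRing (𝓞 (Fp L)) (Fp L))) [ν.IsAddHaarMeasure]

/-- **`ν(D^n) · (ω^𝔻(r_F^𝔻 δ) Φ)(0) = ∫_{𝔸_{L⁺}^n} Φ((u,u) ∘ e₂⁻¹) dν`** for every additive Haar measure `ν`
on `𝔸_{L⁺}^n` and every `Φ ∈ 𝒮(𝔸_{L⁺}^{n+n})`. [cite: GelbartRogawski1991, §3.1 Prop. 3.1.1 p. 455 L1–2]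
[cite: Li1992, (13) pp. 181–182] -/
theorem measure_mul_opD_rDelta_apply_zero (Φ : piSchwartzBruhat (Fp L) (Fin (n + n))) :
    ((ν (piFundamentalDomain (Fp L) (Fin n))).toReal : ℂ) *
        opD L e dV hdV dW hdW (rDelta L e dV hdV hdV0 dW hdW hdW0) Φ 0 =
      ∫ u, (Φ : (Fin (n + n) → (AdeleRing (𝓞 (Fp L)) (Fp L))) → ℂ) (fun i => Sum.elim u u
        (finSumFinEquiv.symm i)) ∂ν := by
  rw [rDelta_eq_rFD_doublingDeltaRat]
  exact measure_mul_omega_ratThetaLiftCont_doublingDeltaRat_apply_zero (Fp L) ν (gramR L e dV hdV dW hdW)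
    (isUnit_gramR L e dV hdV hdV0 dW hdW hdW0) (gramDA_eq_doubledGramFin L e dV hdV dW hdW)
    (isUnit_det_gramDA L e dV hdV hdV0 dW hdW hdW0) Φ

/-- the same on `R_{e₂} Ψ`, `Ψ ∈ 𝒮(𝔸_{L⁺}^{n ⊕ n})`: `ν(D^n) · (ω^𝔻(r_F^𝔻 δ)(R_{e₂} Ψ))(0) = ∫ Ψ(u,u) dν`.
[cite: GelbartRogawski1991, §3.1 Prop. 3.1.1 p. 455 L1–2] [cite: Li1992, (13) pp. 181–182] -/
theorem measure_mul_opD_rDelta_piSBReindex_apply_zero (Ψ : piSchwartzBruhat (Fp L) (Fin n ⊕ Fin n)) :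
    ((ν (piFundamentalDomain (Fp L) (Fin n))).toReal : ℂ) *
        opD L e dV hdV dW hdW (rDelta L e dV hdV hdV0 dW hdW hdW0) (piSBReindex (Fp L) finSumFinEquiv Ψ) 0 =
      ∫ u, (Ψ : (Fin n ⊕ Fin n → (AdeleRing (𝓞 (Fp L)) (Fp L))) → ℂ) (Sum.elim u u) ∂ν := by
  rw [rDelta_eq_rFD_doublingDeltaRat]
  exact measure_mul_omega_ratThetaLiftCont_doublingDeltaRat_piSBReindex_apply_zero (Fp L) ν
      (gramR L e dV hdV dW hdW)
    (isUnit_gramR L e dV hdV hdV0 dW hdW hdW0) (gramDA_eq_doubledGramFin L e dV hdV dW hdW)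
    (isUnit_det_gramDA L e dV hdV hdV0 dW hdW hdW0) Ψ

/-- the same on `R_{e₂}(φ₁ ⊠ φ̄₂)`: `ν(D^n) · (ω^𝔻(r_F^𝔻 δ)(R_{e₂}(φ₁ ⊠ φ̄₂)))(0) = ∫ φ₁ φ̄₂ dν`.
[cite: GelbartRogawski1991, §3.1 Prop. 3.1.1 p. 455 L1–2] [cite: Li1992, (13) pp. 181–182] -/
theorem measure_mul_opD_rDelta_boxConj_apply_zero (φ₁ φ₂ : piSchwartzBruhat (Fp L) (Fin n)) :
    ((ν (piFundamentalDomain (Fp L) (Fin n))).toReal : ℂ) *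
        opD L e dV hdV dW hdW (rDelta L e dV hdV hdV0 dW hdW hdW0)
          (piSBReindex (Fp L) finSumFinEquiv
            (tensorToSum (Fp L) (Fin n) (Fin n) φ₁ (piSchwartzBruhatConj (Fp L) (Fin n) φ₂))) 0 =
      ∫ u,
        (φ₁ : (Fin n → (AdeleRing (𝓞 (Fp L)) (Fp L))) → ℂ) u *
          conj ((φ₂ : (Fin n → (AdeleRing (𝓞 (Fp L)) (Fp L))) → ℂ) u) ∂ν := by
  rw [rDelta_eq_rFD_doublingDeltaRat]
  exact measure_mul_omega_ratThetaLiftCont_doublingDeltaRat_boxConj_apply_zero (Fp L) ν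
    (gramR L e dV hdV dW hdW) (isUnit_gramR L e dV hdV hdV0 dW hdW hdW0)
    (gramDA_eq_doubledGramFin L e dV hdV dW hdW) (isUnit_det_gramDA L e dV hdV hdV0 dW hdW hdW0) φ₁ φ₂

/-- **Tamagawa normalisation `ν(D^n) = 1`: `(ω^𝔻(r_F^𝔻 δ) Φ)(0) = ∫ Φ((u,u) ∘ e₂⁻¹) dν`.**
[cite: GelbartRogawski1991, §3.1 Prop. 3.1.1 p. 455 L1–2] [cite: Li1992, (13) pp. 181–182]
[cite: HarrisKudlaSweet1996, (1.16) p. 952] -/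
theorem opD_rDelta_apply_zero (hν : ν (piFundamentalDomain (Fp L) (Fin n)) = 1)
    (Φ : piSchwartzBruhat (Fp L) (Fin (n + n))) :
    opD L e dV hdV dW hdW (rDelta L e dV hdV hdV0 dW hdW hdW0) Φ 0 =
      ∫ u, (Φ : (Fin (n + n) → (AdeleRing (𝓞 (Fp L)) (Fp L))) → ℂ) (fun i => Sum.elim u u
        (finSumFinEquiv.symm i)) ∂ν := by
  rw [rDelta_eq_rFD_doublingDeltaRat]
  exact omega_ratThetaLiftCont_doublingDeltaRat_apply_zero (Fp L) ν (gramR L e dV hdV dW hdW)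
    (isUnit_gramR L e dV hdV hdV0 dW hdW hdW0) (gramDA_eq_doubledGramFin L e dV hdV dW hdW)
    (isUnit_det_gramDA L e dV hdV hdV0 dW hdW hdW0) hν Φ

/-- Tamagawa `ν`: `(ω^𝔻(r_F^𝔻 δ)(R_{e₂} Ψ))(0) = ∫ Ψ(u,u) dν`.
[cite: GelbartRogawski1991, §3.1 Prop. 3.1.1 p. 455 L1–2] [cite: Li1992, (13) pp. 181–182] -/
theorem opD_rDelta_piSBReindex_apply_zero (hν : ν (piFundamentalDomain (Fp L) (Fin n)) = 1)
    (Ψ : piSchwartzBruhat (Fp L) (Fin n ⊕ Fin n)) :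
    opD L e dV hdV dW hdW (rDelta L e dV hdV hdV0 dW hdW hdW0) (piSBReindex (Fp L) finSumFinEquiv Ψ) 0 =
      ∫ u, (Ψ : (Fin n ⊕ Fin n → (AdeleRing (𝓞 (Fp L)) (Fp L))) → ℂ) (Sum.elim u u) ∂ν := by
  rw [rDelta_eq_rFD_doublingDeltaRat]
  exact omega_ratThetaLiftCont_doublingDeltaRat_piSBReindex_apply_zero (Fp L) ν (gramR L e dV hdV dW hdW)
    (isUnit_gramR L e dV hdV hdV0 dW hdW hdW0) (gramDA_eq_doubledGramFin L e dV hdV dW hdW)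
    (isUnit_det_gramDA L e dV hdV hdV0 dW hdW hdW0) hν Ψ

/-- **Tamagawa `ν`: `(ω^𝔻(r_F^𝔻 δ)(R_{e₂}(φ₁ ⊠ φ̄₂)))(0) = ∫ φ₁ φ̄₂ dν = ⟨φ₁, φ₂⟩`** — the doubled vacuum
value is the `L²` inner product. [cite: GelbartRogawski1991, §3.1 Prop. 3.1.1 p. 455 L1–2]
[cite: Li1992, (13) pp. 181–182] [cite: HarrisKudlaSweet1996, (1.16) p. 952] -/
theorem opD_rDelta_boxConj_apply_zero (hν : ν (piFundamentalDomain (Fp L) (Fin n)) = 1)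
    (φ₁ φ₂ : piSchwartzBruhat (Fp L) (Fin n)) :
    opD L e dV hdV dW hdW (rDelta L e dV hdV hdV0 dW hdW hdW0)
        (piSBReindex (Fp L) finSumFinEquiv
          (tensorToSum (Fp L) (Fin n) (Fin n) φ₁ (piSchwartzBruhatConj (Fp L) (Fin n) φ₂))) 0 =
      ∫ u,
        (φ₁ : (Fin n → (AdeleRing (𝓞 (Fp L)) (Fp L))) → ℂ) u *
          conj ((φ₂ : (Fin n → (AdeleRing (𝓞 (Fp L)) (Fp L))) → ℂ) u) ∂ν := by
  rw [rDelta_eq_rFD_doublingDeltaRat]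
  exact omega_ratThetaLiftCont_doublingDeltaRat_boxConj_apply_zero (Fp L) ν (gramR L e dV hdV dW hdW)
    (isUnit_gramR L e dV hdV hdV0 dW hdW hdW0) (gramDA_eq_doubledGramFin L e dV hdV dW hdW)
    (isUnit_det_gramDA L e dV hdV hdV0 dW hdW hdW0) hν φ₁ φ₂

end Measure

/-! ## §3 Non-vanishing of the doubled vacuum value -/

/-- **`(ω^𝔻(r_F^𝔻 δ)(R_{e₂}(φ ⊠ φ̄)))(0) ≠ 0` for every non-zero `φ ∈ 𝒮(𝔸_{L⁺}^n)`** (no measure in the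
statement: `ν(D^n) ·` this value `= ‖φ‖²_{L²(ν)} > 0` for any additive Haar measure `ν`).
[cite: GelbartRogawski1991, §3.1 Prop. 3.1.1 p. 455 L1–2] [cite: Li1992, (13) pp. 181–182] -/
theorem opD_rDelta_boxConj_apply_zero_ne_zero (φ : piSchwartzBruhat (Fp L) (Fin n)) (hφ : φ ≠ 0) :
    opD L e dV hdV dW hdW (rDelta L e dV hdV hdV0 dW hdW hdW0)
        (piSBReindex (Fp L) finSumFinEquiv
          (tensorToSum (Fp L) (Fin n) (Fin n) φ (piSchwartzBruhatConj (Fp L) (Fin n) φ))) 0 ≠ 0 := by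
  rw [rDelta_eq_rFD_doublingDeltaRat]
  exact omega_ratThetaLiftCont_doublingDeltaRat_boxConj_apply_zero_ne_zero (Fp L) (gramR L e dV hdV dW hdW)
    (isUnit_gramR L e dV hdV hdV0 dW hdW hdW0) (gramDA_eq_doubledGramFin L e dV hdV dW hdW)
    (isUnit_det_gramDA L e dV hdV hdV0 dW hdW hdW0) φ hφ

/-- **`(ω^𝔻(r_F^𝔻 δ) Φ)(0) ≠ 0` whenever the diagonal restriction `u ↦ Φ((u,u) ∘ e₂⁻¹)` is a non-negative
real function, not identically zero** (no measure in the statement; covers a doubled vacuum = real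
Gaussian ⊗ lattice indicator with no product decomposition of `Φ`).
[cite: GelbartRogawski1991, §3.1 Prop. 3.1.1 p. 455 L1–2] [cite: Li1992, (13) pp. 181–182] -/
theorem opD_rDelta_apply_zero_ne_zero_of_diag_nonneg (Φ : piSchwartzBruhat (Fp L) (Fin (n + n)))
    (h0 : ∀ u : Fin n → AdeleRing (𝓞 (Fp L)) (Fp L),
      0 ≤ (Φ : (Fin (n + n) → AdeleRing (𝓞 (Fp L)) (Fp L)) → ℂ)
        (fun i => Sum.elim u u (finSumFinEquiv.symm i)))
    (hne : ∃ u : Fin n → AdeleRing (𝓞 (Fp L)) (Fp L),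
      (Φ : (Fin (n + n) → AdeleRing (𝓞 (Fp L)) (Fp L)) → ℂ) (fun i => Sum.elim u u (finSumFinEquiv.symm i))
        ≠ 0) :
    opD L e dV hdV dW hdW (rDelta L e dV hdV hdV0 dW hdW hdW0) Φ 0 ≠ 0 := by
  rw [rDelta_eq_rFD_doublingDeltaRat]
  exact omega_ratThetaLiftCont_doublingDeltaRat_apply_zero_ne_zero_of_diag_nonneg (Fp L)
    (gramR L e dV hdV dW hdW) (isUnit_gramR L e dV hdV hdV0 dW hdW hdW0)
    (gramDA_eq_doubledGramFin L e dV hdV dW hdW) (isUnit_det_gramDA L e dV hdV hdV0 dW hdW hdW0) Φ h0 hne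

end Literature.NumberTheory.GelbartRogawski1991.GRConstruction
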